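import Summits.AtomisticToContinuum.HydrodynamicLimit.Theorems.EquilibriumClampedCollisionalWindowLD.Negative.PulseCoarse

/-!
# Scaling of the block constants (helper file of the refutation of `EquilibriumClampedCollisionalWindowLD`, stmt-AtomisticToContinuum-13733; see `Cruxes/EquilibriumClampedCollisionalWindowLD/Disproof.lean` and the evidence WITNESS.md; no Theses declaration is asserted positively; refuter-cdisprove-stmt-AtomisticToContinuum-13733-0)
-/

noncomputable section

open Real
open scoped InnerProductSpace

namespace Summit.AtomisticToContinuum.HydrodynamicLimit.Theorems

namespace EquilibriumClampedCollisionalWindowLDNegative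

/-! ### Scaling of the constants (lengths and times by `c`, velocities fixed) -/

section Scaling

/-- Rescale lengths and times by `c > 0`. [folklore] -/
def Params.scale (P : Params) (c : ℝ) : Params :=
  { s := c * P.s, ε := c * P.ε, V := P.V, r := c * P.r, u := P.u, Tmax := c * P.Tmax, αs := P.αs, K := P.K }

namespace Params

variable (P : Params) (c : ℝ)

/-- `scale_s` (technical, see the section header). [folklore] -/
@[simp] theorem scale_s : (P.scale c).s = c * P.s := rfl
/-- `scale_ε` (technical, see the section header). [folklore] -/
@[simp] theorem scale_ε : (P.scale c).ε = c * P.ε := rfl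
/-- `scale_V` (technical, see the section header). [folklore] -/
@[simp] theorem scale_V : (P.scale c).V = P.V := rfl
/-- `scale_r` (technical, see the section header). [folklore] -/
@[simp] theorem scale_r : (P.scale c).r = c * P.r := rfl
/-- `scale_u` (technical, see the section header). [folklore] -/
@[simp] theorem scale_u : (P.scale c).u = P.u := rfl
/-- `scale_T` (technical, see the section header). [folklore] -/
@[simp] theorem scale_T : (P.scale c).Tmax = c * P.Tmax := rfl
/-- `scale_αs` (technical, see the section header). [folklore] -/
@[simp] theorem scale_αs : (P.scale c).αs = P.αs := rfl
/-- `scale_K` (technical, see the section header). [folklore] -/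
@[simp] theorem scale_K : (P.scale c).K = P.K := rfl
/-- `scale_g` (technical, see the section header). [folklore] -/
@[simp] theorem scale_g : (P.scale c).g = c * P.g := by simp only [g, scale_s, scale_ε]; ring
/-- `scale_δs` (technical, see the section header). [folklore] -/
@[simp] theorem scale_δs : (P.scale c).δs = c * P.δs := by simp only [δs, scale_r, scale_T, scale_u]; ring
/-- `scale_αp` (technical, see the section header). [folklore] -/
@[simp] theorem scale_αp : (P.scale c).αp = P.αp := by simp only [αp, scale_αs, scale_u, scale_V]
/-- `scale_ps` (technical, see the section header). [folklore] -/
@[simp] theorem scale_ps : (P.scale c).ps = c * P.ps := by simp only [ps, scale_s, scale_αp, scale_δs]; ring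

variable {c} (hc : c ≠ 0)
include hc

/-- `k1` (technical, see the section header). [folklore] -/
private theorem k1 : (c * P.ps) ^ 2 / (c * P.ε) = c * (P.ps ^ 2 / P.ε) := by
  rw [mul_pow, sq c, mul_assoc, mul_div_mul_left _ _ hc, mul_div_assoc]
/-- `k2` (technical, see the section header). [folklore] -/
private theorem k2 : (c * P.ps) ^ 2 / (c * P.ε) ^ 2 = P.ps ^ 2 / P.ε ^ 2 := by
  rw [mul_pow, mul_pow, mul_div_mul_left _ _ (pow_ne_zero 2 hc)]
/-- `k3` (technical, see the section header). [folklore] -/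
private theorem k3 : c * P.ps / (c * P.ε) = P.ps / P.ε := mul_div_mul_left _ _ hc

/-- `scale_νs` (technical, see the section header). [folklore] -/
theorem scale_νs : (P.scale c).νs = c * P.νs := by
  simp only [νs, scale_δs, scale_ps, scale_ε, k1 P hc]; ring
/-- `scale_dV` (technical, see the section header). [folklore] -/
theorem scale_dV : (P.scale c).dV = P.dV := by
  simp only [dV, scale_u, scale_V, scale_ps, scale_ε, k2 P hc]
/-- `scale_Vlo` (technical, see the section header). [folklore] -/
theorem scale_Vlo : (P.scale c).Vlo = P.Vlo := by simp only [Vlo, scale_V, scale_u, scale_K, scale_dV P hc]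
/-- `scale_Vhi` (technical, see the section header). [folklore] -/
theorem scale_Vhi : (P.scale c).Vhi = P.Vhi := by simp only [Vhi, scale_V, scale_u, scale_K, scale_dV P hc]
/-- `scale_θlo` (technical, see the section header). [folklore] -/
theorem scale_θlo : (P.scale c).θlo = c * P.θlo := by
  simp only [θlo, scale_g, scale_νs P hc, scale_Vhi P hc]; ring
/-- `scale_θhi` (technical, see the section header). [folklore] -/
theorem scale_θhi : (P.scale c).θhi = c * P.θhi := by
  simp only [θhi, scale_g, scale_νs P hc, scale_Vlo P hc]; ring
/-- `scale_αn` (technical, see the section header). [folklore] -/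
theorem scale_αn : (P.scale c).αn = P.αn := by
  simp only [αn, scale_g, scale_αp, scale_δs, scale_ps, scale_ε, k1 P hc]
  rw [show c * P.g * P.αp + 2 * (c * P.δs) + c * (P.ps ^ 2 / P.ε) = c * (P.g * P.αp + 2 * P.δs + P.ps ^ 2 / P.ε) by ring,
    mul_div_mul_left _ _ hc]
/-- `scale_clo` (technical, see the section header). [folklore] -/
theorem scale_clo : (P.scale c).clo = P.clo := by
  simp only [clo, scale_Vlo P hc, scale_ps, scale_ε, k2 P hc]
/-- `scale_ρs` (technical, see the section header). [folklore] -/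
theorem scale_ρs : (P.scale c).ρs = P.ρs := by
  simp only [ρs, scale_Vhi P hc, scale_ps, scale_ε, scale_u]
  rw [show 2 * P.Vhi * (c * P.ps) / (c * P.ε) = 2 * P.Vhi * (c * P.ps / (c * P.ε)) by ring, k3 P hc]
  ring
/-- `scale_errA` (technical, see the section header). [folklore] -/
theorem scale_errA : (P.scale c).errA = c * P.errA := by
  simp only [errA, scale_r, scale_T, scale_u, scale_ρs P hc]; ring
/-- `scale_fwd` (technical, see the section header). [folklore] -/
theorem scale_fwd : (P.scale c).fwd = c * P.fwd := by
  simp only [fwd, scale_θhi P hc, scale_Vhi P hc, scale_r, scale_T, scale_u, scale_ρs P hc]; ring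

omit hc in
/-- **Admissibility is scale invariant.** [folklore] -/
theorem Admissible.scale {c : ℝ} (hc : 0 < c) (h : P.Admissible) : (P.scale c).Admissible := by
  have hc' := hc.ne'
  exact
  { ε_pos := by rw [scale_ε]; exact mul_pos hc h.ε_pos
    ε_lt_s := by rw [scale_ε, scale_s]; exact mul_lt_mul_of_pos_left h.ε_lt_s hc
    s_le := by rw [scale_ε, scale_s]; nlinarith [h.s_le]
    V_pos := h.V_pos
    r_nn := by rw [scale_r]; exact mul_nonneg hc.le h.r_nn
    u_nn := h.u_nn
    T_nn := by rw [scale_T]; exact mul_nonneg hc.le h.T_nn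
    αs_nn := h.αs_nn
    small := by rw [scale_s, scale_αp, scale_δs, scale_g]; nlinarith [h.small]
    Vlo_ge := by rw [scale_V, scale_Vlo P hc']; exact h.Vlo_ge
    Vhi_le := by rw [scale_V, scale_Vhi P hc']; exact h.Vhi_le
    u_le := h.u_le
    ps_le := by rw [scale_ps, scale_ε]; nlinarith [h.ps_le]
    α_closes := by rw [scale_αn P hc', scale_u, scale_clo P hc', scale_αs]; exact h.α_closes
    T_ge := by rw [scale_K, scale_θhi P hc', scale_T]; nlinarith [h.T_ge]
    νs_lt := by rw [scale_νs P hc', scale_g]; exact mul_lt_mul_of_pos_left h.νs_lt hc }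

omit hc in
/-- **The separation conditions are scale invariant.** [folklore] -/
theorem SepOK.scale {c : ℝ} (hc : 0 < c) (h : P.SepOK) : (P.scale c).SepOK := by
  have hc' := hc.ne'
  exact
  { adm := Admissible.scale P hc h.adm
    αs_le := h.αs_le
    αn_le := by rw [scale_αn P hc']; exact h.αn_le
    sep2 := by rw [scale_ε, scale_fwd P hc', scale_errA P hc', scale_s]; nlinarith [h.sep2]
    adjSS := by
      rw [scale_ε, scale_αn P hc', scale_θlo P hc', scale_Vlo P hc', scale_u, scale_αs, scale_T, scale_ρs P hc']
      nlinarith [h.adjSS] }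

omit hc in
/-- Scaling by `1` does nothing. [folklore] -/
@[simp] theorem scale_one (P : Params) : P.scale 1 = P := by
  cases P; simp [Params.scale]

omit hc in
/-- Scaling is multiplicative: rescaling by `c` and then by `d` rescales by `d * c`. [folklore] -/
theorem scale_scale (P : Params) (c d : ℝ) : (P.scale c).scale d = P.scale (d * c) := by
  simp [Params.scale, mul_assoc]

end Params

end Scaling

end EquilibriumClampedCollisionalWindowLDNegative

end Summit.AtomisticToContinuum.HydrodynamicLimit.Theorems

end
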